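import Literature.NumberTheory.Automorphic.Liu2021.AppendixC.HeckeImage
import Literature.NumberTheory.Automorphic.Liu2021.AppendixC.EtaleH1TowerHeckeAdjoint
import Literature.RingTheory.CentralSimple.AdjointAntiInvolutionStableSubalgebra
import Mathlib.LinearAlgebra.Dual.Lemmas
import HarnessLib

/-!
# [Liu 2021, App. D p. 133 / §4.2] the image of the Hecke algebra in `End⁰(A_K)` is stable under any anti-involution that is
# the adjoint for a Hecke-adjoint level form on `H¹_ét(A_K)` — the (T3) junction of the road (P) toward the S2′ socket `SocketRos`

Topic `NumberTheory/Automorphic/Liu2021/AppendixC`; namespace `….AppendixC.Sec42Data.HeckeTranslates`.  THEOREMS ONLY (no definition, no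
named fact, no instance, no `sorry`).  Cell `hodgecm-mathlib` (D-0151), fan A, count-neutral capital (`--supports stmt-HodgeConjecture-24832`):
leg (T3b) of A-p07 (g12)'s census `CENSUS-RoadP-P2P3-currency` §3 — the INSTANTIATION of the generic ★
`RingTheory/CentralSimple/AdjointAntiInvolutionStableSubalgebra` at one level `K` of the tree's CONSTRUCTED Albanese tower.  HC_CM is proved only
modulo the 7 printed citations until rung 0 closes; nothing of [Liu2021] is asserted here.

Print.  [Liu2021] App. D, p. 133 (before (D.3), FJcycle.tex l. 5463–5476): the Hecke correspondences induce «`C_c^∞(K\G(𝔸^∞)/K, ℚ) → End(A_K)_ℚ`»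
whose image (the tree's ★ `heckeImage hD K = ℚ[{heckeEnd hD K g}_g]`) is stable under the Rosati involution of the canonical polarisation,
because the transpose of `T(KgK)` is `T(Kg⁻¹K)`; [MumfordAV1970] §20–§21: the Rosati involution is the adjoint for the Riemann/Weil form
and is positive.

WHAT IS PROVED (level `K` fixed; `ρ x := ᵗ(V_ℓ^ℚ x)` the dual `ℓ`-adic realisation of `x ∈ End⁰(A_K)` on `H¹_ét(A_K) = (V_ℓ A_K)^∨`):
* §1 `dualMap_rationalTateAction_injective` — `x ↦ ᵗ(V_ℓ^ℚ x)` is injective (★ `rationalTateAction_injective`, [MumfordAV1970] §19 Thm. 3,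
  and duality on the finite-dimensional `V_ℓ A_K`).
* §2 For a bilinear form `e` on `H¹_ét(A_K)` which is right-separating, a self-map `ι` of `End⁰(A_K)` REALISED AS THE `e`-ADJOINT
  (`e (ρ x φ) ψ = e φ (ρ (ι x) ψ)`), and the Hecke adjointness `e (ρ [KgK] φ) ψ = e φ (ρ [Kg⁻¹K] ψ)` (the output of ★
  `HeckeOperatorAdjointBilinear` / `EtaleH1TowerHeckeAdjoint` read at level `K`):
  **`apply_heckeEnd_eq_heckeEnd_inv_of_isAdjointPair`** — `ι [KgK] = [Kg⁻¹K]`;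
  **`apply_mem_heckeImage_of_isAdjointPair`** — for `ι` an anti-involution, `ι (heckeImage K) ⊆ heckeImage K`;
  **`exists_isPositiveAntiInvolution_heckeImage_stable_of_isAdjointPair`** — for `ι` a POSITIVE anti-involution, the `SocketRos` shape at
  level `K`: `∃ τ, IsPositiveAntiInvolution (End⁰ A_K) τ ∧ ∀ x ∈ heckeImage K, τ x ∈ heckeImage K`.
The producer of `(e, ι, hadj)` is the road (P) ((P1)/(P2): canonical polarisations `Θ_K`, their `ℓ`-adic Weil pairings dualised to `H¹`, and the
Rosati involution as adjoint); the Hecke adjointness is ★ (T1)/(T1′) on the tower form of ★ (T2b) `EtaleH1TowerPairing`.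

## References
* [Liu2021] Y. Liu, *Fourier–Jacobi cycles and arithmetic relative trace formula*, Camb. J. Math. 9 (2021): App. D p. 133 (before (D.3)) and §4.2
  (FJcycle.tex l. 2074).
* [MumfordAV1970] D. Mumford, *Abelian Varieties* (1970), §19 Thm. 3 (faithfulness of `T_ℓ`), §21 Thm. 1 (positivity of the Rosati involution).
* Tree: ★ `AppendixC.HeckeEndomorphism` (`heckeEnd`), ★ `AppendixC.HeckeImage` (`heckeImage`), ★ `ComplexMultiplication.TateModuleOfCMFreeRankOne`
  (`rationalTateAction`, `rationalTateAction_injective`), ★ `RingTheory.CentralSimple.AdjointAntiInvolutionStableSubalgebra` ((T3a):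
  `apply_eq_of_isAdjointPair`, `IsAntiInvolution.apply_mem_adjoin_of_forall_exists_isAdjointPair`,
  `IsPositiveAntiInvolution.exists_stable_adjoin_of_forall_exists_isAdjointPair`).
-/

set_option autoImplicit false

noncomputable section

open CategoryTheory NumberField MulAction Function
open Literature.AlgebraicGeometry.Motives.AbelianVariety (rationalTateAction rationalTateAction_injective
  rationalTateAction_algebraMap)
open Literature.RingTheory.CentralSimple

namespace Literature.NumberTheory.Automorphic.Liu2021.AppendixC

variable {F E : Type} [Field F] [NumberField F] [IsTotallyReal F] [Field E] [NumberField E] [Algebra F E]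
  [IsTotallyComplex E] [Algebra.IsQuadraticExtension F E]
variable {P5 : PropC5Data F E} {isotropicAt : ℕ → Prop}

namespace Sec42Data

variable (C : Sec42Data P5 isotropicAt) (ℓ : ℕ) [Fact ℓ.Prime]

/-! ## §1 `x ↦ ᵗ(V_ℓ^ℚ x)` is a faithful realisation of `End⁰(A_K)` on `H¹_ét(A_K)` -/

/-- **`End⁰(A_K) → End(H¹_ét(A_K))`, `x ↦ ᵗ(V_ℓ^ℚ x)`, is injective**: `V_ℓ^ℚ` is injective ([MumfordAV1970] §19 Thm. 3, ★
`rationalTateAction_injective`; `ℓ ≠ 0` in the number field `E`) and an endomorphism of the finite-dimensional `V_ℓ A_K` is determined by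
its transpose (linear forms separate points). [cite: MumfordAV1970, §19 Thm. 3] -/
theorem dualMap_rationalTateAction_injective (K : C5.SmallLevel C.S.K₀) :
    Injective fun x : (C.A K).endAlgebra => (rationalTateAction (C.A K) ℓ x).dualMap := by
  intro x y hxy
  have hℓ : ((ℓ : ℕ) : E) ≠ 0 := Nat.cast_ne_zero.2 (Fact.out : ℓ.Prime).ne_zero
  apply rationalTateAction_injective (A := C.A K) (ℓ := ℓ) hℓ
  refine LinearMap.ext fun v => ?_
  refine sub_eq_zero.1 ((Module.forall_dual_apply_eq_zero_iff ℚ_[ℓ] _).1 fun φ => ?_)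
  have h := congrArg (fun f : Module.End ℚ_[ℓ] (C.etaleH1 ℓ K) => f φ v) hxy
  simp only [LinearMap.dualMap_apply] at h
  rw [map_sub, h, sub_self]

end Sec42Data

namespace Sec42Data.HeckeTranslates

variable {C : Sec42Data P5 isotropicAt} (T : C.HeckeTranslates) (ℓ : ℕ) [Fact ℓ.Prime]

/-! ## §2 At one level: an `e`-adjoint self-map sends `[KgK]` to its `e`-adjoint; an `e`-adjoint anti-involution stabilises the Hecke image -/

/-- **`ι [KgK] = s'` whenever `ᵗV_ℓ(s')` is an `e`-adjoint of `ᵗV_ℓ[KgK]`** — for any self-map `ι` of `End⁰(A_K)` realised as the adjoint for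
a right-separating bilinear form `e` on `H¹_ét(A_K)` (`e (ᵗV_ℓ(x) φ) ψ = e φ (ᵗV_ℓ(ι x) ψ)`).  With `s' = [Kg⁻¹K]` (symmetric degrees) or
`s' = (#(KgK/K)/#(Kg⁻¹K/K)) • [Kg⁻¹K]` (in general) this reads «the transpose of `T(KgK)` is `T(Kg⁻¹K)`» for the Rosati involution of a
Hecke-compatible polarisation. [cite: Liu2021, p. 133 (before (D.3)) and §4.2 (FJcycle.tex l. 2074)] [cite: MumfordAV1970, §19 Thm. 3] -/
theorem apply_heckeEnd_eq_of_isAdjointPair (hD : T.IsogenyDescent) (K : C5.SmallLevel C.S.K₀)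
    (e : LinearMap.BilinForm ℚ_[ℓ] (C.etaleH1 ℓ K)) (he : e.SeparatingRight)
    (ι : (C.A K).endAlgebra → (C.A K).endAlgebra)
    (hadj : ∀ x : (C.A K).endAlgebra,
      LinearMap.IsAdjointPair e e ((rationalTateAction (C.A K) ℓ x).dualMap) ((rationalTateAction (C.A K) ℓ (ι x)).dualMap))
    (g : C.G) {s' : (C.A K).endAlgebra}
    (hg : LinearMap.IsAdjointPair e e ((rationalTateAction (C.A K) ℓ (T.heckeEnd hD K g)).dualMap)
      ((rationalTateAction (C.A K) ℓ s').dualMap)) :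
    ι (T.heckeEnd hD K g) = s' :=
  apply_eq_of_isAdjointPair e he (fun x : (C.A K).endAlgebra => (rationalTateAction (C.A K) ℓ x).dualMap)
    (C.dualMap_rationalTateAction_injective ℓ K) ι hadj hg

/-- **The Hecke image is stable under an `e`-adjoint anti-involution**: for `ι` an anti-involution of `End⁰(A_K)` realised as the
`e`-adjoint on `H¹_ét(A_K)` (`e` right-separating), if every `ᵗV_ℓ[KgK]` has an `e`-adjoint of the form `ᵗV_ℓ(s')` with `s'` IN the Hecke
image `heckeImage K = ℚ[{[KgK]}_g]`, then `ι` maps `heckeImage K` into itself (`ι [KgK] = s' ∈ heckeImage K` by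
`apply_heckeEnd_eq_of_isAdjointPair`, then ★ `IsAntiInvolution.apply_mem_adjoin_of_forall_mem`).
[cite: Liu2021, p. 133 (before (D.3)) and §4.2 (FJcycle.tex l. 2074)] [cite: MumfordAV1970, §21 Thm. 1] -/
theorem apply_mem_heckeImage_of_isAdjointPair (hD : T.IsogenyDescent) (K : C5.SmallLevel C.S.K₀)
    (e : LinearMap.BilinForm ℚ_[ℓ] (C.etaleH1 ℓ K)) (he : e.SeparatingRight)
    {ι : (C.A K).endAlgebra →ₗ[ℚ] (C.A K).endAlgebra} (hι : IsAntiInvolution (C.A K).endAlgebra ι)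
    (hadj : ∀ x : (C.A K).endAlgebra,
      LinearMap.IsAdjointPair e e ((rationalTateAction (C.A K) ℓ x).dualMap) ((rationalTateAction (C.A K) ℓ (ι x)).dualMap))
    (hg : ∀ g : C.G, ∃ s' ∈ T.heckeImage hD K, LinearMap.IsAdjointPair e e
      ((rationalTateAction (C.A K) ℓ (T.heckeEnd hD K g)).dualMap) ((rationalTateAction (C.A K) ℓ s').dualMap))
    {x : (C.A K).endAlgebra} (hx : x ∈ T.heckeImage hD K) : ι x ∈ T.heckeImage hD K := by
  refine hι.apply_mem_adjoin_of_forall_mem ?_ hx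
  rintro _ ⟨g, rfl⟩
  obtain ⟨s', hs'H, hs'⟩ := hg g
  rw [T.apply_heckeEnd_eq_of_isAdjointPair ℓ hD K e he ι hadj g hs']
  exact hs'H

/-- **The `SocketRos` shape at level `K`.**  A POSITIVE anti-involution `ι` of `End⁰(A_K)` (Rosati, [MumfordAV1970] §21 Thm. 1) realised as
the adjoint for a right-separating bilinear form `e` on `H¹_ét(A_K)` for which every `ᵗV_ℓ[KgK]` has an `e`-adjoint `ᵗV_ℓ(s')`, `s'` in the
Hecke image, gives «a positive anti-involution of `End⁰(A_K)` stabilising the Hecke image»: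
`∃ τ, IsPositiveAntiInvolution (End⁰ A_K) τ ∧ ∀ x ∈ heckeImage K, τ x ∈ heckeImage K` (namely `τ = ι`).
[cite: Liu2021, p. 133 (before (D.3)) and §4.2 (FJcycle.tex l. 2074)] [cite: MumfordAV1970, §21 Thm. 1] -/
theorem exists_isPositiveAntiInvolution_heckeImage_stable_of_isAdjointPair (hD : T.IsogenyDescent) (K : C5.SmallLevel C.S.K₀)
    (e : LinearMap.BilinForm ℚ_[ℓ] (C.etaleH1 ℓ K)) (he : e.SeparatingRight)
    {ι : (C.A K).endAlgebra →ₗ[ℚ] (C.A K).endAlgebra} (hι : IsPositiveAntiInvolution (C.A K).endAlgebra ι)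
    (hadj : ∀ x : (C.A K).endAlgebra,
      LinearMap.IsAdjointPair e e ((rationalTateAction (C.A K) ℓ x).dualMap) ((rationalTateAction (C.A K) ℓ (ι x)).dualMap))
    (hg : ∀ g : C.G, ∃ s' ∈ T.heckeImage hD K, LinearMap.IsAdjointPair e e
      ((rationalTateAction (C.A K) ℓ (T.heckeEnd hD K g)).dualMap) ((rationalTateAction (C.A K) ℓ s').dualMap)) :
    ∃ τ : (C.A K).endAlgebra →ₗ[ℚ] (C.A K).endAlgebra,
      IsPositiveAntiInvolution (C.A K).endAlgebra τ ∧ ∀ x ∈ T.heckeImage hD K, τ x ∈ T.heckeImage hD K :=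
  ⟨ι, hι, fun _ hx => T.apply_mem_heckeImage_of_isAdjointPair ℓ hD K e he hι.toIsAntiInvolution hadj hg hx⟩

/-! ## §3 On the tower: an `etHeckeRep`-invariant form `B` on `H¹_ét(A_∞)` read at level `K` (no unimodularity input) -/

/-- a rational multiple inside: `ᵗV_ℓ(q · x) ψ = q • ᵗV_ℓ(x) ψ` (`V_ℓ^ℚ` is `ℚ`-linear, ★ `rationalTateAction_algebraMap`). [folklore] -/
private theorem dualMap_rationalTateAction_algebraMap_mul (K : C5.SmallLevel C.S.K₀) (q : ℚ) (x : (C.A K).endAlgebra)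
    (ψ : C.etaleH1 ℓ K) :
    (rationalTateAction (C.A K) ℓ (algebraMap ℚ (C.A K).endAlgebra q * x)).dualMap ψ =
      (algebraMap ℚ ℚ_[ℓ] q) • (rationalTateAction (C.A K) ℓ x).dualMap ψ := by
  ext v
  simp only [LinearMap.dualMap_apply, map_mul, rationalTateAction_algebraMap, LinearMap.smul_apply, smul_eq_mul,
    Module.End.mul_apply, Module.algebraMap_end_apply, map_smul]

/-- **Every `ᵗV_ℓ[KgK]` has an adjoint IN THE HECKE IMAGE for the level-`K` restriction of an invariant tower form** — namely
`ᵗV_ℓ(s')` with `s' = (#(KgK/K)/#(Kg⁻¹K/K)) · [Kg⁻¹K] ∈ heckeImage K` (★ (T1′) `bilin_toTower_ncard_smul_heckeEnd_eq`; no symmetric-degree /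
unimodularity input). [cite: Liu2021, p. 133 (before (D.3)) and §4.2 (FJcycle.tex l. 2074)] [cite: DiamondShurman2005, Prop. 5.5.2] -/
theorem exists_mem_heckeImage_isAdjointPair_toTower (hD : T.IsogenyDescent) (B : LinearMap.BilinForm ℚ_[ℓ] (C.etaleH1Tower ℓ))
    (hB : ∀ (g : C.G) (x y : C.etaleH1Tower ℓ), B (T.etHeckeRep ℓ g x) (T.etHeckeRep ℓ g y) = B x y)
    (K : C5.SmallLevel C.S.K₀) (g : C.G) :
    ∃ s' ∈ T.heckeImage hD K,
      LinearMap.IsAdjointPair (B.compl₁₂ (C.toTower ℓ K) (C.toTower ℓ K)) (B.compl₁₂ (C.toTower ℓ K) (C.toTower ℓ K))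
        ((rationalTateAction (C.A K) ℓ (T.heckeEnd hD K g)).dualMap) ((rationalTateAction (C.A K) ℓ s').dualMap) := by
  have hpos := ncard_orbit_level_pos K g⁻¹
  set n : ℕ := (orbit K.1.1 (g : C.G ⧸ (K.1.1 : Subgroup C.G))).ncard with hn
  set n' : ℕ := (orbit K.1.1 ((g⁻¹ : C.G) : C.G ⧸ (K.1.1 : Subgroup C.G))).ncard with hn'
  have hn'0 : (n' : ℚ_[ℓ]) ≠ 0 := Nat.cast_ne_zero.2 hpos.ne'
  refine ⟨algebraMap ℚ (C.A K).endAlgebra ((n : ℚ) / (n' : ℚ)) * T.heckeEnd hD K g⁻¹,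
    Subalgebra.mul_mem _ (Subalgebra.algebraMap_mem _ _) (T.heckeEnd_mem_heckeImage hD K g⁻¹), fun φ ψ => ?_⟩
  have h := T.bilin_toTower_ncard_smul_heckeEnd_eq ℓ hD B hB K g φ ψ
  rw [← hn, ← hn', ← Nat.cast_smul_eq_nsmul ℚ_[ℓ], ← Nat.cast_smul_eq_nsmul ℚ_[ℓ]] at h
  simp only [LinearMap.compl₁₂_apply]
  rw [dualMap_rationalTateAction_algebraMap_mul ℓ K, LinearMap.map_smul, LinearMap.map_smul, map_div₀, map_natCast,
    map_natCast, div_eq_inv_mul, mul_smul, eq_inv_smul_iff₀ hn'0, h]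

/-- **On the tower: the Hecke image is stable** under an anti-involution `ι` of `End⁰(A_K)` realised as the adjoint for the level-`K`
restriction of an `etHeckeRep`-invariant form `B` on `H¹_ét(A_∞)` which is right-separating at level `K` — no symmetric-degree input.
[cite: Liu2021, p. 133 (before (D.3)) and §4.2 (FJcycle.tex l. 2074)] [cite: MumfordAV1970, §21 Thm. 1] -/
theorem apply_mem_heckeImage (hD : T.IsogenyDescent) (K : C5.SmallLevel C.S.K₀)
    (B : LinearMap.BilinForm ℚ_[ℓ] (C.etaleH1Tower ℓ))
    (hB : ∀ (g : C.G) (x y : C.etaleH1Tower ℓ), B (T.etHeckeRep ℓ g x) (T.etHeckeRep ℓ g y) = B x y)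
    (hsep : ∀ ψ : C.etaleH1 ℓ K, (∀ φ : C.etaleH1 ℓ K, B (C.toTower ℓ K φ) (C.toTower ℓ K ψ) = 0) → ψ = 0)
    {ι : (C.A K).endAlgebra →ₗ[ℚ] (C.A K).endAlgebra} (hι : IsAntiInvolution (C.A K).endAlgebra ι)
    (hadj : ∀ (x : (C.A K).endAlgebra) (φ ψ : C.etaleH1 ℓ K),
      B (C.toTower ℓ K ((rationalTateAction (C.A K) ℓ x).dualMap φ)) (C.toTower ℓ K ψ) =
        B (C.toTower ℓ K φ) (C.toTower ℓ K ((rationalTateAction (C.A K) ℓ (ι x)).dualMap ψ)))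
    {x : (C.A K).endAlgebra} (hx : x ∈ T.heckeImage hD K) : ι x ∈ T.heckeImage hD K :=
  T.apply_mem_heckeImage_of_isAdjointPair ℓ hD K (B.compl₁₂ (C.toTower ℓ K) (C.toTower ℓ K))
    (fun ψ h => hsep ψ fun φ => by simpa only [LinearMap.compl₁₂_apply] using h φ) hι
    (fun x φ ψ => by simpa only [LinearMap.compl₁₂_apply] using hadj x φ ψ)
    (fun g => T.exists_mem_heckeImage_isAdjointPair_toTower ℓ hD B hB K g) hx

/-- **On the tower, symmetric degrees: `ι [KgK] = [Kg⁻¹K]`** for a self-map `ι` of `End⁰(A_K)` realised as the adjoint for the level-`K`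
restriction (right-separating) of an `etHeckeRep`-invariant form `B` on `H¹_ét(A_∞)`, given `#(Kg⁻¹K/K) = #(KgK/K)` (unimodularity; ★
`HeckeOperatorAdjoint.ncard_orbit_inv_eq_of_isCompact_isOpen`). [cite: Liu2021, p. 133 (before (D.3)) and §4.2 (FJcycle.tex l. 2074)]
[cite: DiamondShurman2005, Prop. 5.5.2] -/
theorem apply_heckeEnd_eq_heckeEnd_inv (hD : T.IsogenyDescent) (K : C5.SmallLevel C.S.K₀)
    (B : LinearMap.BilinForm ℚ_[ℓ] (C.etaleH1Tower ℓ))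
    (hB : ∀ (g : C.G) (x y : C.etaleH1Tower ℓ), B (T.etHeckeRep ℓ g x) (T.etHeckeRep ℓ g y) = B x y)
    (hsep : ∀ ψ : C.etaleH1 ℓ K, (∀ φ : C.etaleH1 ℓ K, B (C.toTower ℓ K φ) (C.toTower ℓ K ψ) = 0) → ψ = 0)
    (ι : (C.A K).endAlgebra → (C.A K).endAlgebra)
    (hadj : ∀ (x : (C.A K).endAlgebra) (φ ψ : C.etaleH1 ℓ K),
      B (C.toTower ℓ K ((rationalTateAction (C.A K) ℓ x).dualMap φ)) (C.toTower ℓ K ψ) =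
        B (C.toTower ℓ K φ) (C.toTower ℓ K ((rationalTateAction (C.A K) ℓ (ι x)).dualMap ψ)))
    (g : C.G)
    (hdeg : (orbit K.1.1 ((g⁻¹ : C.G) : C.G ⧸ (K.1.1 : Subgroup C.G))).ncard =
      (orbit K.1.1 (g : C.G ⧸ (K.1.1 : Subgroup C.G))).ncard) :
    ι (T.heckeEnd hD K g) = T.heckeEnd hD K g⁻¹ :=
  T.apply_heckeEnd_eq_of_isAdjointPair ℓ hD K (B.compl₁₂ (C.toTower ℓ K) (C.toTower ℓ K))
    (fun ψ h => hsep ψ fun φ => by simpa only [LinearMap.compl₁₂_apply] using h φ) ι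
    (fun x φ ψ => by simpa only [LinearMap.compl₁₂_apply] using hadj x φ ψ) g
    (fun φ ψ => by simpa only [LinearMap.compl₁₂_apply] using T.bilin_toTower_heckeEnd_eq ℓ hD B hB K g hdeg φ ψ)

/-- **The `SocketRos` producer on the tower (all levels; no unimodularity input).**  Given an `etHeckeRep`-invariant bilinear form `B` on
`H¹_ét(A_∞)` (★ (T2b) `exists_bilinForm_etaleH1Tower`) which is right-separating on every level, and at every level `K` a POSITIVE
anti-involution `ι K` of `End⁰(A_K)` (Rosati) realised as the `B`-adjoint at level `K`: for every `K` «a positive anti-involution of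
`End⁰(A_K)` stabilising the Hecke image» — `∀ K, ∃ τ, IsPositiveAntiInvolution (End⁰ A_K) τ ∧ ∀ x ∈ heckeImage K, τ x ∈ heckeImage K`
(the cell's socket `SocketRos T hD` verbatim). [cite: Liu2021, p. 133 (before (D.3)) and §4.2 (FJcycle.tex l. 2074)]
[cite: MumfordAV1970, §21 Thm. 1] -/
theorem forall_exists_isPositiveAntiInvolution_heckeImage_stable (hD : T.IsogenyDescent)
    (B : LinearMap.BilinForm ℚ_[ℓ] (C.etaleH1Tower ℓ))
    (hB : ∀ (g : C.G) (x y : C.etaleH1Tower ℓ), B (T.etHeckeRep ℓ g x) (T.etHeckeRep ℓ g y) = B x y)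
    (hsep : ∀ (K : C5.SmallLevel C.S.K₀) (ψ : C.etaleH1 ℓ K), (∀ φ : C.etaleH1 ℓ K, B (C.toTower ℓ K φ) (C.toTower ℓ K ψ) = 0) → ψ = 0)
    (ι : ∀ K : C5.SmallLevel C.S.K₀, (C.A K).endAlgebra →ₗ[ℚ] (C.A K).endAlgebra)
    (hι : ∀ K, IsPositiveAntiInvolution (C.A K).endAlgebra (ι K))
    (hadj : ∀ (K : C5.SmallLevel C.S.K₀) (x : (C.A K).endAlgebra) (φ ψ : C.etaleH1 ℓ K),
      B (C.toTower ℓ K ((rationalTateAction (C.A K) ℓ x).dualMap φ)) (C.toTower ℓ K ψ) =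
        B (C.toTower ℓ K φ) (C.toTower ℓ K ((rationalTateAction (C.A K) ℓ (ι K x)).dualMap ψ)))
    (K : C5.SmallLevel C.S.K₀) :
    ∃ τ : (C.A K).endAlgebra →ₗ[ℚ] (C.A K).endAlgebra,
      IsPositiveAntiInvolution (C.A K).endAlgebra τ ∧ ∀ x ∈ T.heckeImage hD K, τ x ∈ T.heckeImage hD K :=
  ⟨ι K, hι K, fun _ hx => T.apply_mem_heckeImage ℓ hD K B hB (hsep K) (hι K).toIsAntiInvolution (hadj K) hx⟩

end Sec42Data.HeckeTranslates

end Literature.NumberTheory.Automorphic.Liu2021.AppendixC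

end
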